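import Mathlib
import HarnessLib
import Summits.Ventures.LatticeQCDFlow.Scaling.AbsoluteMomentCLT
import Summits.Ventures.LatticeQCDFlow.Scaling.CharFunTaylorBound

/-!
# LatticeQCDFlow / Scaling — a TRIANGULAR central limit theorem for the rows of product families
# (bounded, `V`-dependent block law and block statistic) and the partition function along the array

HONEST FRAMING: exact (Metropolis-corrected) sampling algorithms for lattice gauge theory;
figures of merit are autocorrelation/cost numbers at stated couplings and volumes; no
continuum-physics claim.

Venture `LatticeQCDFlow` (cell pub-lqcd), topic `Scaling`; FANOUT row 3 (`s0-u1-a`, S0-B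
implementation A, GEN-19).  NEW WORK of the cell (Mathlib has the i.i.d. central limit theorem only;
this is the Lyapunov route for triangular arrays of ROWS `(Fin V → Y, ρ_V^{⊗V})` with bounded
summands, through row 3's explicit third-order bounds `Scaling/CharFunTaylorBound`, the row
characteristic function `pi_charFun_inv_sqrt_mul_sum` of `Scaling/AbsoluteMomentCLT`, Lévy's theorem
and Mathlib's `Complex.tendsto_one_add_pow_exp_of_tendsto`); NO definition is introduced; nothing is
cited.  It is the probabilistic half of row 3's LOG-NORMAL UNIVERSALITY theorem for factorised flow
samplers (`Scaling/LogNormalUniversality`): only `σ² = lim V·Var(ℓ_V)` of the per-block log-weight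
survives in the large-volume acceptance.

## Content (all `[ours]`)

* `variance_limit_nonneg`;
* **`triangularPi_tendstoInDistribution`** — block laws `ρ_V`, bounded centred block statistics
  `h_V` (`|h_V| ≤ K`) with `Var_{ρ_V}(h_V) → σ²`: `V^{-1/2}Σᵢ h_V(yᵢ) ⇒ N(0, σ²)` on
  `(Fin V → Y, ρ_V^{⊗V})`;
* **`triangular_mgf_inv_sqrt_pow_tendsto`** — `M_V(1/√V)^V → e^{σ²/2}` along the array.

NOT CLAIMED: unbounded summands (Lindeberg); non-identical blocks within a row; rates.
-/

noncomputable section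

namespace Summit.Ventures.LatticeQCDFlow.Theory2

open MeasureTheory ProbabilityTheory Filter Finset Real Set Complex
open scoped Topology NNReal

/-! ## §1 The triangular central limit theorem for the rows of product families -/

section TriangularCLT

variable {Y : Type*} {mY : MeasurableSpace Y} {ρ : ℕ → Measure Y} [∀ V, IsProbabilityMeasure (ρ V)]
  {h : ℕ → Y → ℝ}
variable {Ω' : Type*} {mΩ' : MeasurableSpace Ω'} {P' : Measure Ω'} [IsProbabilityMeasure P']

omit [∀ V, IsProbabilityMeasure (ρ V)] in
/-- The limit of the variances along the array is non-negative. [ours] -/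
theorem variance_limit_nonneg {σ2 : ℝ} (hσ : Tendsto (fun V => Var[h V; ρ V]) atTop (𝓝 σ2)) :
    0 ≤ σ2 :=
  ge_of_tendsto' hσ fun n => variance_nonneg (h n) (ρ n)

/-- **THE TRIANGULAR CLT FOR ROWS.**  Block laws `ρ_V`, bounded centred block statistics `h_V`
(`|h_V| ≤ K`, `∫ h_V dρ_V = 0`) with `Var_{ρ_V}(h_V) → σ²`: the normalised row sums
`V^{-1/2} Σ_{i<V} h_V(yᵢ)` on `(Fin V → Y, ρ_V^{⊗V})` converge in distribution to `N(0, σ²)`. [ours] -/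
theorem triangularPi_tendstoInDistribution (hm : ∀ V, Measurable (h V)) {K : ℝ}
    (hK : ∀ V y, |h V y| ≤ K) (h0 : ∀ V, ∫ y, h V y ∂ρ V = 0) {σ2 : ℝ}
    (hσ : Tendsto (fun V => Var[h V; ρ V]) atTop (𝓝 σ2))
    {Z : Ω' → ℝ} (hZ : HasLaw Z (gaussianReal 0 σ2.toNNReal) P') :
    TendstoInDistribution (fun (V : ℕ) (y : Fin V → Y) => (Real.sqrt V)⁻¹ * ∑ i, h V (y i)) atTop Z
      (fun V => Measure.pi fun _ : Fin V => ρ V) P' where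
  forall_aemeasurable V := (Finset.aemeasurable_fun_sum _ fun i _ =>
    pi_aemeasurable_comp_eval (hm V).aemeasurable V i).const_mul _
  aemeasurable_limit := hZ.aemeasurable
  tendsto := by
    have hσ0 : 0 ≤ σ2 := variance_limit_nonneg hσ
    refine ProbabilityMeasure.tendsto_iff_tendsto_charFun.2 fun t => ?_
    simp only [ProbabilityMeasure.coe_mk, pi_charFun_inv_sqrt_mul_sum (hm _).aemeasurable, hZ.map_eq,
      charFun_gaussianReal, Complex.ofReal_zero, mul_zero, zero_mul, zero_sub,
      Real.coe_toNNReal σ2 hσ0]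
    -- `(φ_V(t/√V))^V = (1 + g V)^V` with `V·g V → −σ² t²/2`
    set g : ℕ → ℂ := fun V => charFun ((ρ V).map (h V)) ((Real.sqrt V)⁻¹ * t) - 1 with hg
    have hlim : Tendsto (fun V : ℕ => (V : ℂ) * g V) atTop (𝓝 (-(σ2 * t ^ 2 / 2 : ℝ) : ℂ)) := by
      -- main term `−t²σ_V²/2` and a remainder `≤ |t|³K³/√V`
      have hmain : Tendsto (fun V : ℕ => ((-(t ^ 2 * Var[h V; ρ V] / 2) : ℝ) : ℂ)) atTop
          (𝓝 ((-(σ2 * t ^ 2 / 2) : ℝ) : ℂ)) := by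
        refine (Complex.continuous_ofReal.tendsto _).comp ?_
        have := ((hσ.const_mul (t ^ 2)).div_const 2).neg
        convert this using 2
        ring
      have hrem : Tendsto (fun V : ℕ => (V : ℂ) * g V - ((-(t ^ 2 * Var[h V; ρ V] / 2) : ℝ) : ℂ))
          atTop (𝓝 0) := by
        rw [tendsto_zero_iff_norm_tendsto_zero]
        have hbound : ∀ V : ℕ, 0 < V → ‖(V : ℂ) * g V - ((-(t ^ 2 * Var[h V; ρ V] / 2) : ℝ) : ℂ)‖
            ≤ |t| ^ 3 * K ^ 3 / Real.sqrt V := by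
          intro V hV
          have hsV : 0 < Real.sqrt V := Real.sqrt_pos.2 (Nat.cast_pos.2 hV)
          have hVc : (V : ℂ) ≠ 0 := by exact_mod_cast hV.ne'
          have hT := norm_charFun_map_sub_taylor_le (ρ V) (hm V) (hK V) (h0 V) ((Real.sqrt V)⁻¹ * t)
          -- `V · (φ − 1 + u²σ²/2) = V g − (−t²σ²/2)` since `V u² = t²`
          have e : (V : ℂ) * g V - ((-(t ^ 2 * Var[h V; ρ V] / 2) : ℝ) : ℂ)
              = (V : ℂ) * (charFun ((ρ V).map (h V)) ((Real.sqrt V)⁻¹ * t)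
                - (1 - ((((Real.sqrt V)⁻¹ * t) ^ 2 * Var[h V; ρ V] / 2 : ℝ)) : ℂ)) := by
            simp only [hg]
            have hsq : ((Real.sqrt V)⁻¹ * t) ^ 2 = t ^ 2 / V := by
              rw [mul_pow, inv_pow, Real.sq_sqrt (Nat.cast_nonneg V)]; ring
            rw [hsq]
            push_cast
            field_simp
            ring
          rw [e, norm_mul, Complex.norm_natCast]
          calc (V : ℝ) * ‖charFun ((ρ V).map (h V)) ((Real.sqrt V)⁻¹ * t)
                - (1 - ((((Real.sqrt V)⁻¹ * t) ^ 2 * Var[h V; ρ V] / 2 : ℝ)) : ℂ)‖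
              ≤ (V : ℝ) * (|(Real.sqrt V)⁻¹ * t| ^ 3 * K ^ 3) :=
                mul_le_mul_of_nonneg_left hT (Nat.cast_nonneg V)
            _ = |t| ^ 3 * K ^ 3 / Real.sqrt V := by
                rw [abs_mul, abs_of_nonneg (inv_nonneg.2 hsV.le), mul_pow, inv_pow]
                have h3 : Real.sqrt V ^ 3 = (V : ℝ) * Real.sqrt V := by
                  rw [pow_succ, Real.sq_sqrt (Nat.cast_nonneg V)]
                rw [h3]
                field_simp
        have hK0 : 0 ≤ K := (abs_nonneg _).trans (hK 0 (Classical.choice (by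
          by_contra hne; rw [not_nonempty_iff] at hne
          exact absurd (IsProbabilityMeasure.measure_univ (μ := ρ 0))
            (by simp [Set.univ_eq_empty_iff.2 hne]))))
        have hup : Tendsto (fun V : ℕ => |t| ^ 3 * K ^ 3 / Real.sqrt V) atTop (𝓝 0) := by
          have := (tendsto_inv_atTop_zero.comp
            (Real.tendsto_sqrt_atTop.comp tendsto_natCast_atTop_atTop)).const_mul (|t| ^ 3 * K ^ 3)
          simpa [div_eq_mul_inv] using this
        exact squeeze_zero' (Filter.Eventually.of_forall fun V => norm_nonneg _)
          ((eventually_gt_atTop 0).mono fun V hV => hbound V hV) hup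
      have := hmain.add hrem
      simpa using this
    have key := Complex.tendsto_one_add_pow_exp_of_tendsto hlim
    have e : ∀ V : ℕ, (1 + g V) = charFun ((ρ V).map (h V)) ((Real.sqrt V)⁻¹ * t) := fun V => by
      simp [hg]
    simp_rw [e] at key
    convert key using 2
    push_cast
    ring

end TriangularCLT


/-! ## §2 The partition function along the array: `M_V(1/√V)^V → e^{σ²/2}` -/

section TriangularMGF

variable {Y : Type*} {mY : MeasurableSpace Y}

/-- **THE PARTITION FUNCTION ALONG THE ARRAY**: block laws `ρ_V`, bounded centred `h_V` (`|h_V| ≤ K`)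
with `Var_{ρ_V}(h_V) → σ²` give `M_V(1/√V)^V → e^{σ²/2}`. [ours] -/
theorem triangular_mgf_inv_sqrt_pow_tendsto {ρ : ℕ → Measure Y} [∀ V, IsProbabilityMeasure (ρ V)]
    {h : ℕ → Y → ℝ} (hm : ∀ V, Measurable (h V)) {K : ℝ} (hK : ∀ V y, |h V y| ≤ K)
    (h0 : ∀ V, ∫ y, h V y ∂ρ V = 0) {σ2 : ℝ} (hσ : Tendsto (fun V => Var[h V; ρ V]) atTop (𝓝 σ2)) :
    Tendsto (fun V : ℕ => mgf (h V) (ρ V) ((Real.sqrt V)⁻¹) ^ V) atTop (𝓝 (Real.exp (σ2 / 2))) := by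
  have hK0 : 0 ≤ K := (abs_nonneg _).trans (hK 0 (Classical.choice (by
    by_contra hne; rw [not_nonempty_iff] at hne
    exact absurd (IsProbabilityMeasure.measure_univ (μ := ρ 0)) (by simp [Set.univ_eq_empty_iff.2 hne]))))
  -- `V · (M_V(1/√V) − 1) → σ²/2`
  set g : ℕ → ℝ := fun V => mgf (h V) (ρ V) ((Real.sqrt V)⁻¹) - 1 with hg
  have hmain : Tendsto (fun V : ℕ => Var[h V; ρ V] / 2) atTop (𝓝 (σ2 / 2)) := hσ.div_const 2
  have hbound : ∀ V : ℕ, 0 < V → K ^ 2 ≤ V →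
      |(V : ℝ) * g V - Var[h V; ρ V] / 2| ≤ K ^ 3 / Real.sqrt V := by
    intro V hV hKV
    have hsV : 0 < Real.sqrt V := Real.sqrt_pos.2 (Nat.cast_pos.2 hV)
    have hu : |(Real.sqrt V)⁻¹| * K ≤ 1 := by
      rw [abs_of_nonneg (inv_nonneg.2 hsV.le), inv_mul_le_iff₀ hsV, mul_one]
      calc K = Real.sqrt (K ^ 2) := (Real.sqrt_sq hK0).symm
        _ ≤ Real.sqrt V := Real.sqrt_le_sqrt hKV
    have hT := abs_mgf_sub_taylor_le (ρ V) (hm V) (hK V) (h0 V) hu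
    have e : (V : ℝ) * g V - Var[h V; ρ V] / 2
        = (V : ℝ) * (mgf (h V) (ρ V) ((Real.sqrt V)⁻¹) - (1 + ((Real.sqrt V)⁻¹) ^ 2 * Var[h V; ρ V] / 2)) := by
      simp only [hg]
      rw [inv_pow, Real.sq_sqrt (Nat.cast_nonneg V)]
      field_simp
      ring
    rw [e, abs_mul, Nat.abs_cast]
    calc (V : ℝ) * |mgf (h V) (ρ V) ((Real.sqrt V)⁻¹) - (1 + ((Real.sqrt V)⁻¹) ^ 2 * Var[h V; ρ V] / 2)|
        ≤ (V : ℝ) * (|(Real.sqrt V)⁻¹| ^ 3 * K ^ 3) := mul_le_mul_of_nonneg_left hT (Nat.cast_nonneg V)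
      _ = K ^ 3 / Real.sqrt V := by
          rw [abs_of_nonneg (inv_nonneg.2 hsV.le), inv_pow]
          have h3 : Real.sqrt V ^ 3 = (V : ℝ) * Real.sqrt V := by
            rw [pow_succ, Real.sq_sqrt (Nat.cast_nonneg V)]
          rw [h3]
          field_simp
  have hrem : Tendsto (fun V : ℕ => (V : ℝ) * g V - Var[h V; ρ V] / 2) atTop (𝓝 0) := by
    have hup : Tendsto (fun V : ℕ => K ^ 3 / Real.sqrt V) atTop (𝓝 0) := by
      have := (tendsto_inv_atTop_zero.comp
        (Real.tendsto_sqrt_atTop.comp tendsto_natCast_atTop_atTop)).const_mul (K ^ 3)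
      simpa [div_eq_mul_inv] using this
    refine squeeze_zero_norm' ?_ hup
    have hev : ∀ᶠ V : ℕ in atTop, (K ^ 2 ≤ (V : ℝ)) := by
      obtain ⟨N, hN⟩ := exists_nat_ge (K ^ 2)
      exact (eventually_ge_atTop N).mono fun V hV => hN.trans (by exact_mod_cast hV)
    filter_upwards [eventually_gt_atTop 0, hev] with V hV hKV
    rw [Real.norm_eq_abs]; exact hbound V hV hKV
  have hlim : Tendsto (fun V : ℕ => (V : ℝ) * g V) atTop (𝓝 (σ2 / 2)) := by
    have := hmain.add hrem
    simpa using this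
  -- `(1 + g V)^V → e^{σ²/2}` through the complex lemma
  have hC : Tendsto (fun V : ℕ => (V : ℂ) * (g V : ℂ)) atTop (𝓝 ((σ2 / 2 : ℝ) : ℂ)) := by
    have := (Complex.continuous_ofReal.tendsto _).comp hlim
    refine this.congr fun V => ?_
    simp
  have key := Complex.tendsto_one_add_pow_exp_of_tendsto hC
  have hre := (Complex.continuous_re.tendsto _).comp key
  rw [Complex.exp_ofReal_re] at hre
  have e1 : ∀ V : ℕ, ((1 + (g V : ℂ)) ^ V).re = mgf (h V) (ρ V) ((Real.sqrt V)⁻¹) ^ V := fun V => by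
    rw [show (1 : ℂ) + (g V : ℂ) = ((1 + g V : ℝ) : ℂ) by push_cast; rfl, ← Complex.ofReal_pow,
      Complex.ofReal_re]
    simp [hg]
  refine hre.congr fun V => ?_
  simp only [Function.comp_apply]
  exact e1 V

end TriangularMGF


end Summit.Ventures.LatticeQCDFlow.Theory2

end
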